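import Summits.ValiantsHypothesis.ValiantsHypothesis.Theses.BorderApolarity
import Literature.Computability.AlgebraicComplexity.Apolarity

/-!
# drefute probe: `stub_kuratowskiSubmodule` of line `cone-purity-squeeze` (crux stmt-ValiantsHypothesis-5778), verbatim

Kuratowski limits (in the coefficient topology) of `d`-planes of degree-`k` forms are `d`-planes.
Route: restrict coefficient vectors to the (finitely many) degree-`k` exponents, `T k : 𝕊 →ₗ (degF → ℂ)`
(injective on forms of degree `k`, with section `S k`); `L` is a subspace by (Li)+(Ls) and continuity;
`finrank ≤ d` by normalised dependence relations + compactness of the unit sphere of `Fin (d+1) → ℂ`;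
`finrank ≥ d` by intersecting each `A t` with a complement `W` of `L` inside the degree-`k` forms, normalising,
extracting a convergent subsequence on the unit sphere of `degF → ℂ` (this is where (Ls) = W3 is consumed),
and closedness of finite-dimensional subspaces.
-/

open MvPolynomial Filter Topology
open scoped BigOperators
open Literature.Computability.AlgebraicComplexity

namespace DrefuteProbe.Kuratowski

set_option linter.unusedSectionVars false

noncomputable section

section Coord

variable {σ : Type} [Fintype σ] [DecidableEq σ]

/-- Degree-`k` exponents, as a finset. -/
def degF (σ : Type) [Fintype σ] [DecidableEq σ] (k : ℕ) : Finset (σ →₀ ℕ) :=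
  (Finset.univ : Finset σ).finsuppAntidiag k

theorem mem_degF {k : ℕ} {u : σ →₀ ℕ} : u ∈ degF σ k ↔ u.degree = k := by
  rw [degF, Finset.mem_finsuppAntidiag, Finsupp.degree_eq_sum]
  simp

/-- Restriction of the coefficient vector to degree `k`. -/
def T (k : ℕ) : MvPolynomial σ ℂ →ₗ[ℂ] (degF σ k → ℂ) where
  toFun p := fun u => coeff u.1 p
  map_add' p q := by funext u; simp
  map_smul' c p := by funext u; simp

theorem T_apply (k : ℕ) (p : MvPolynomial σ ℂ) (u : degF σ k) : T k p u = coeff u.1 p := rfl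

/-- The degree-`k` form with prescribed degree-`k` coefficients. -/
def S (k : ℕ) (v : degF σ k → ℂ) : MvPolynomial σ ℂ := ∑ u : degF σ k, monomial u.1 (v u)

theorem coeff_S (k : ℕ) (v : degF σ k → ℂ) (w : σ →₀ ℕ) :
    coeff w (S k v) = if h : w ∈ degF σ k then v ⟨w, h⟩ else 0 := by
  rw [S, coeff_sum]
  simp only [coeff_monomial]
  split_ifs with h
  · rw [Finset.sum_eq_single ⟨w, h⟩]
    · simp
    · intro u _ hu
      rw [if_neg]
      intro heq
      exact hu (Subtype.ext heq)
    · intro hu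
      exact absurd (Finset.mem_univ _) hu
  · apply Finset.sum_eq_zero
    intro u _
    rw [if_neg]
    intro heq
    exact h (heq ▸ u.2)

theorem isHomogeneous_S (k : ℕ) (v : degF σ k → ℂ) : (S k v).IsHomogeneous k := by
  unfold S
  apply IsHomogeneous.sum
  intro u _
  exact isHomogeneous_monomial _ (mem_degF.mp u.2)

theorem T_S (k : ℕ) (v : degF σ k → ℂ) : T k (S k v) = v := by
  funext u
  rw [T_apply, coeff_S, dif_pos u.2]

theorem S_T (k : ℕ) {p : MvPolynomial σ ℂ} (hp : p.IsHomogeneous k) : S k (T k p) = p := by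
  ext w
  rw [coeff_S]
  split_ifs with h
  · rfl
  · exact (hp.coeff_eq_zero (fun hw => h (mem_degF.mpr hw))).symm

theorem eq_of_T_eq (k : ℕ) {p q : MvPolynomial σ ℂ} (hp : p.IsHomogeneous k) (hq : q.IsHomogeneous k)
    (h : T k p = T k q) : p = q := by
  rw [← S_T k hp, ← S_T k hq, h]

theorem T_eq_zero_iff (k : ℕ) {p : MvPolynomial σ ℂ} (hp : p.IsHomogeneous k) : T k p = 0 ↔ p = 0 :=
  ⟨fun h => eq_of_T_eq k hp (isHomogeneous_zero σ ℂ k) (by rw [h, map_zero]),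
    fun h => by rw [h, map_zero]⟩

/-- Coefficientwise convergence of degree-`k` forms = convergence of the degree-`k` coordinates. -/
theorem tendsto_T_iff (k : ℕ) {x : ℕ → MvPolynomial σ ℂ} {p : MvPolynomial σ ℂ}
    (hx : ∀ t, (x t).IsHomogeneous k) (hp : p.IsHomogeneous k) :
    Tendsto (fun t => coeffVec (x t)) atTop (𝓝 (coeffVec p)) ↔
      Tendsto (fun t => T k (x t)) atTop (𝓝 (T k p)) := by
  rw [tendsto_pi_nhds, tendsto_pi_nhds]
  constructor
  · intro h u
    exact h u.1
  · intro h w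
    by_cases hw : w.degree = k
    · exact h ⟨w, mem_degF.mpr hw⟩
    · have h1 : (fun t => coeffVec (x t) w) = fun _ => (0 : ℂ) :=
        funext fun t => (hx t).coeff_eq_zero hw
      have h2 : coeffVec p w = 0 := hp.coeff_eq_zero hw
      rw [h1, h2]
      exact tendsto_const_nhds

end Coord

/-- **Stub 4 of `cone-purity-squeeze`, verbatim.** -/
theorem stub_kuratowskiSubmodule {σ : Type} [Fintype σ] (k d : ℕ)
    (A : ℕ → Submodule ℂ (MvPolynomial σ ℂ)) (L : Set (MvPolynomial σ ℂ))
    (hA : ∀ t, A t ≤ MvPolynomial.homogeneousSubmodule σ ℂ k)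
    (hd : ∀ t, Module.finrank ℂ (A t) = d)
    (hLi : ∀ D ∈ L, ∃ Ds : ℕ → MvPolynomial σ ℂ, (∀ t, Ds t ∈ A t) ∧
      Tendsto (fun t => coeffVec (Ds t)) atTop (nhds (coeffVec D)))
    (hLs : ∀ (D : MvPolynomial σ ℂ) (φ : ℕ → ℕ) (Ds : ℕ → MvPolynomial σ ℂ), StrictMono φ →
      (∀ t, Ds t ∈ A (φ t)) → Tendsto (fun t => coeffVec (Ds t)) atTop (nhds (coeffVec D)) → D ∈ L) :
    ∃ Lk : Submodule ℂ (MvPolynomial σ ℂ), (Lk : Set (MvPolynomial σ ℂ)) = L ∧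
      Lk ≤ MvPolynomial.homogeneousSubmodule σ ℂ k ∧ Module.finrank ℂ Lk = d := by
  classical
  -- the ambient finite-dimensional space of degree-`k` forms
  haveI hVfin : FiniteDimensional ℂ (homogeneousSubmodule σ ℂ k) := by
    apply Submodule.finiteDimensional_of_le (S₂ := restrictTotalDegree σ ℂ k)
    intro E hE
    rw [mem_restrictTotalDegree]
    exact ((mem_homogeneousSubmodule k E).mp hE).totalDegree_le
  haveI hAfin : ∀ t, FiniteDimensional ℂ (A t) := fun t => Submodule.finiteDimensional_of_le (hA t)
  have hAhom : ∀ t, ∀ p ∈ A t, p.IsHomogeneous k := fun t p hp =>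
    (mem_homogeneousSubmodule k p).mp (hA t hp)
  -- Step 1: `L` consists of degree-`k` forms
  have hLhom : ∀ D ∈ L, D.IsHomogeneous k := by
    intro D hD
    obtain ⟨Ds, hDs, hlim⟩ := hLi D hD
    intro w hw
    by_contra hne
    apply hw
    have h1 : Tendsto (fun t => coeffVec (Ds t) w) atTop (𝓝 (coeffVec D w)) :=
      ((continuous_apply w).tendsto _).comp hlim
    have h2 : (fun t => coeffVec (Ds t) w) = fun _ => (0 : ℂ) :=
      funext fun t => (hAhom t _ (hDs t)).coeff_eq_zero (d := w)
        (by rw [Finsupp.degree_eq_weight_one]; exact hne)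
    rw [h2] at h1
    exact tendsto_nhds_unique h1 tendsto_const_nhds
  -- Step 2: `L` is a subspace
  have hL0 : (0 : MvPolynomial σ ℂ) ∈ L :=
    hLs 0 id (fun _ => 0) strictMono_id (fun t => (A t).zero_mem) tendsto_const_nhds
  have hcoeffVec_add : ∀ p q : MvPolynomial σ ℂ, coeffVec (p + q) = coeffVec p + coeffVec q :=
    fun p q => funext fun w => coeff_add w p q
  have hcoeffVec_smul : ∀ (c : ℂ) (p : MvPolynomial σ ℂ), coeffVec (c • p) = c • coeffVec p :=
    fun c p => funext fun w => by simp [coeffVec]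
  have hLadd : ∀ p ∈ L, ∀ q ∈ L, p + q ∈ L := by
    intro p hp q hq
    obtain ⟨Ps, hPs, hPl⟩ := hLi p hp
    obtain ⟨Qs, hQs, hQl⟩ := hLi q hq
    refine hLs (p + q) id (fun t => Ps t + Qs t) strictMono_id
      (fun t => (A t).add_mem (hPs t) (hQs t)) ?_
    simp only [hcoeffVec_add]
    exact hPl.add hQl
  have hLsmul : ∀ (c : ℂ) (p : MvPolynomial σ ℂ), p ∈ L → c • p ∈ L := by
    intro c p hp
    obtain ⟨Ps, hPs, hPl⟩ := hLi p hp
    refine hLs (c • p) id (fun t => c • Ps t) strictMono_id (fun t => (A t).smul_mem c (hPs t)) ?_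
    simp only [hcoeffVec_smul]
    exact hPl.const_smul c
  let Lk : Submodule ℂ (MvPolynomial σ ℂ) :=
    { carrier := L
      add_mem' := fun {p q} hp hq => hLadd p hp q hq
      zero_mem' := hL0
      smul_mem' := fun c p hp => hLsmul c p hp }
  have hLkV : Lk ≤ homogeneousSubmodule σ ℂ k := fun D hD =>
    (mem_homogeneousSubmodule k D).mpr (hLhom D hD)
  haveI : FiniteDimensional ℂ Lk := Submodule.finiteDimensional_of_le hLkV
  refine ⟨Lk, rfl, hLkV, le_antisymm ?_ ?_⟩
  · -- Step 3: `finrank Lk ≤ d` (normalised dependence relations in `A t`)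
    by_contra hgt
    push Not at hgt
    have hcard : d + 1 ≤ Module.finrank ℂ Lk := hgt
    let b := Module.finBasis ℂ Lk
    let e : Fin (d + 1) → Lk := fun i => b (Fin.castLE hcard i)
    have he : LinearIndependent ℂ e := b.linearIndependent.comp _ (Fin.castLE_injective hcard)
    have hex : ∀ i : Fin (d + 1), ∃ Ds : ℕ → MvPolynomial σ ℂ, (∀ t, Ds t ∈ A t) ∧
        Tendsto (fun t => coeffVec (Ds t)) atTop (𝓝 (coeffVec (e i : MvPolynomial σ ℂ))) :=
      fun i => hLi _ (e i).2
    choose E hEA hElim using hex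
    have hdep : ∀ t, ∃ c : Fin (d + 1) → ℂ, ‖c‖ = 1 ∧ ∑ i, c i • E i t = 0 := by
      intro t
      have hnot : ¬ LinearIndependent ℂ (fun i => (⟨E i t, hEA i t⟩ : A t)) := by
        intro hli
        have := hli.fintype_card_le_finrank
        rw [Fintype.card_fin, hd t] at this
        omega
      rw [Fintype.not_linearIndependent_iff] at hnot
      obtain ⟨g, hg, i, hi⟩ := hnot
      have hg0 : g ≠ 0 := fun h => hi (by rw [h]; rfl)
      have hn : ‖g‖ ≠ 0 := norm_ne_zero_iff.mpr hg0
      have hsum : ∑ i, g i • E i t = 0 := by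
        have := congrArg (fun x : A t => (x : MvPolynomial σ ℂ)) hg
        simpa using this
      refine ⟨((‖g‖⁻¹ : ℝ) : ℂ) • g, ?_, ?_⟩
      · rw [norm_smul, Complex.norm_real, norm_inv, norm_norm, inv_mul_cancel₀ hn]
      · simp only [Pi.smul_apply, smul_eq_mul, mul_smul, ← Finset.smul_sum, hsum, smul_zero]
    choose c hc1 hc0 using hdep
    obtain ⟨cl, hclS, φ, hφ, hclim⟩ := (isCompact_sphere (0 : Fin (d + 1) → ℂ) 1).tendsto_subseq
      (x := c) (fun t => mem_sphere_zero_iff_norm.mpr (hc1 t))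
    have hcl0 : cl ≠ 0 := by
      intro h
      rw [h, mem_sphere_zero_iff_norm, norm_zero] at hclS
      exact zero_ne_one hclS
    have hThom : ∀ i t, (E i t).IsHomogeneous k := fun i t => hAhom t _ (hEA i t)
    have hehom : ∀ i, (e i : MvPolynomial σ ℂ).IsHomogeneous k := fun i => hLhom _ (e i).2
    have hTlim : ∀ i, Tendsto (fun t => T k (E i (φ t))) atTop (𝓝 (T k (e i : MvPolynomial σ ℂ))) :=
      fun i => ((tendsto_T_iff k (hThom i) (hehom i)).mp (hElim i)).comp hφ.tendsto_atTop
    have hclim' : ∀ i, Tendsto (fun t => c (φ t) i) atTop (𝓝 (cl i)) := fun i =>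
      ((continuous_apply i).tendsto _).comp hclim
    have hsum : Tendsto (fun t => ∑ i, c (φ t) i • T k (E i (φ t))) atTop
        (𝓝 (∑ i, cl i • T k (e i : MvPolynomial σ ℂ))) :=
      tendsto_finsetSum _ fun i _ => (hclim' i).smul (hTlim i)
    have hzero : (fun t => ∑ i, c (φ t) i • T k (E i (φ t))) = fun _ => 0 := by
      funext t
      have := congrArg (T k) (hc0 (φ t))
      rw [map_sum, map_zero] at this
      simpa only [map_smul] using this
    rw [hzero] at hsum
    have hlim0 : ∑ i, cl i • T k (e i : MvPolynomial σ ℂ) = 0 :=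
      tendsto_nhds_unique hsum tendsto_const_nhds
    have hVsum : (∑ i, cl i • (e i : MvPolynomial σ ℂ)).IsHomogeneous k :=
      (mem_homogeneousSubmodule k _).mp
        ((homogeneousSubmodule σ ℂ k).sum_mem fun i _ =>
          (homogeneousSubmodule σ ℂ k).smul_mem _ (hLkV (e i).2))
    have key : ∑ i, cl i • (e i : MvPolynomial σ ℂ) = 0 := by
      apply (T_eq_zero_iff k hVsum).mp
      rw [map_sum]
      simpa only [map_smul] using hlim0
    have key' : ∑ i, cl i • e i = 0 := by
      apply Subtype.ext
      simpa using key
    have := Fintype.linearIndependent_iff.mp he cl key'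
    exact hcl0 (funext this)
  · -- Step 4: `d ≤ finrank Lk` (compactness; consumes (Ls))
    by_contra hlt
    push Not at hlt
    let LV : Submodule ℂ (homogeneousSubmodule σ ℂ k) := Lk.comap (homogeneousSubmodule σ ℂ k).subtype
    have hLV : Module.finrank ℂ LV = Module.finrank ℂ Lk :=
      (Submodule.comapSubtypeEquivOfLe hLkV).finrank_eq
    obtain ⟨W, hW⟩ := LV.exists_isCompl
    have hWdim : Module.finrank ℂ LV + Module.finrank ℂ W =
        Module.finrank ℂ (homogeneousSubmodule σ ℂ k) :=
      Submodule.finrank_add_eq_of_isCompl hW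
    -- in each `A t`, a nonzero vector of `W`
    have hAt : ∀ t, ∃ w : homogeneousSubmodule σ ℂ k,
        (w : MvPolynomial σ ℂ) ∈ A t ∧ w ∈ W ∧ w ≠ 0 := by
      intro t
      let At : Submodule ℂ (homogeneousSubmodule σ ℂ k) :=
        (A t).comap (homogeneousSubmodule σ ℂ k).subtype
      have hAtd : Module.finrank ℂ At = d := by
        rw [(Submodule.comapSubtypeEquivOfLe (hA t)).finrank_eq, hd t]
      have hsup : Module.finrank ℂ ↥(At ⊔ W) ≤ Module.finrank ℂ (homogeneousSubmodule σ ℂ k) :=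
        Submodule.finrank_le _
      have hinf := Submodule.finrank_sup_add_finrank_inf_eq At W
      have hpos : 0 < Module.finrank ℂ ↥(At ⊓ W) := by omega
      have hne : At ⊓ W ≠ ⊥ := by
        intro h
        rw [h, finrank_bot] at hpos
        exact lt_irrefl _ hpos
      obtain ⟨x, hx, hx0⟩ := Submodule.exists_mem_ne_zero_of_ne_bot hne
      exact ⟨x, (Submodule.mem_inf.mp hx).1, (Submodule.mem_inf.mp hx).2, hx0⟩
    choose w hwA hwW hw0 using hAt
    have hwhom : ∀ t, ((w t : homogeneousSubmodule σ ℂ k) : MvPolynomial σ ℂ).IsHomogeneous k :=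
      fun t => hAhom t _ (hwA t)
    have hT0 : ∀ t, T k ((w t : homogeneousSubmodule σ ℂ k) : MvPolynomial σ ℂ) ≠ 0 := by
      intro t h
      apply hw0 t
      apply Subtype.ext
      exact (T_eq_zero_iff k (hwhom t)).mp h
    set r : ℕ → ℂ := fun t => ((‖T k ((w t : homogeneousSubmodule σ ℂ k) : MvPolynomial σ ℂ)‖⁻¹ : ℝ) : ℂ)
      with hr
    have hsph : ∀ t, r t • T k ((w t : homogeneousSubmodule σ ℂ k) : MvPolynomial σ ℂ) ∈
        Metric.sphere (0 : degF σ k → ℂ) 1 := by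
      intro t
      rw [mem_sphere_zero_iff_norm, norm_smul, hr]
      simp only [Complex.norm_real, norm_inv, norm_norm]
      exact inv_mul_cancel₀ (norm_ne_zero_iff.mpr (hT0 t))
    obtain ⟨v, hvS, φ, hφ, hvlim⟩ := (isCompact_sphere (0 : degF σ k → ℂ) 1).tendsto_subseq hsph
    have hv0 : v ≠ 0 := by
      intro h
      rw [h, mem_sphere_zero_iff_norm, norm_zero] at hvS
      exact zero_ne_one hvS
    -- the limit form
    set ℓ := S k v with hℓ
    have hℓhom : ℓ.IsHomogeneous k := isHomogeneous_S k v
    have hTℓ : T k ℓ = v := T_S k v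
    -- `ℓ ∈ L` by (Ls)
    have hℓL : ℓ ∈ L := by
      refine hLs ℓ φ (fun t => r (φ t) • ((w (φ t) : homogeneousSubmodule σ ℂ k) : MvPolynomial σ ℂ)) hφ
        (fun t => (A (φ t)).smul_mem _ (hwA (φ t))) ?_
      rw [tendsto_T_iff k (fun t => ?_) hℓhom]
      · simpa only [map_smul, hTℓ, Function.comp_def] using hvlim
      · exact (mem_homogeneousSubmodule k _).mp
          ((homogeneousSubmodule σ ℂ k).smul_mem _ (w (φ t)).2)
    -- `ℓ ∈ W` by closedness of finite-dimensional subspaces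
    have hℓV : ℓ ∈ homogeneousSubmodule σ ℂ k := (mem_homogeneousSubmodule k ℓ).mpr hℓhom
    have hℓW : (⟨ℓ, hℓV⟩ : homogeneousSubmodule σ ℂ k) ∈ W := by
      let W' : Submodule ℂ (degF σ k → ℂ) := W.map ((T k).comp (homogeneousSubmodule σ ℂ k).subtype)
      have hW'closed : IsClosed (W' : Set (degF σ k → ℂ)) := W'.closed_of_finiteDimensional
      have hmemW' : ∀ t, r (φ t) • T k ((w (φ t) : homogeneousSubmodule σ ℂ k) : MvPolynomial σ ℂ) ∈ W' :=
        fun t => W'.smul_mem _ (Submodule.mem_map_of_mem (hwW (φ t)))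
      have hvW' : v ∈ W' := hW'closed.mem_of_tendsto hvlim (Eventually.of_forall hmemW')
      obtain ⟨w₀, hw₀W, hw₀v⟩ := Submodule.mem_map.mp hvW'
      have : (⟨ℓ, hℓV⟩ : homogeneousSubmodule σ ℂ k) = w₀ := by
        apply Subtype.ext
        show ℓ = (w₀ : MvPolynomial σ ℂ)
        apply eq_of_T_eq k hℓhom ((mem_homogeneousSubmodule k _).mp w₀.2)
        rw [hTℓ, ← hw₀v]
        rfl
      rw [this]
      exact hw₀W
    have hℓLV : (⟨ℓ, hℓV⟩ : homogeneousSubmodule σ ℂ k) ∈ LV := hℓL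
    have hzero : (⟨ℓ, hℓV⟩ : homogeneousSubmodule σ ℂ k) = 0 := by
      have := hW.disjoint
      rw [Submodule.disjoint_def] at this
      exact this _ hℓLV hℓW
    have hℓ0 : ℓ = 0 := congrArg Subtype.val hzero
    apply hv0
    rw [← hTℓ, hℓ0, map_zero]

end

end DrefuteProbe.Kuratowski

#print axioms DrefuteProbe.Kuratowski.stub_kuratowskiSubmodule
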